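import Mathlib
import HarnessLib
import Summits.HubbardSuperconductivity.HubbardSuperconductivity.Theorems.KLProgrammeKLRegimeWickScaleFlowRiccati
import Summits.HubbardSuperconductivity.HubbardSuperconductivity.Theorems.KLProgrammeKLRegimeWickScaleFlowRungs
import Summits.HubbardSuperconductivity.HubbardSuperconductivity.Theorems.KLProgrammeKLRegimeEngineLadderIncrement

/-!
# Route `KLProgramme` — crux K3, ENGINE child (gen 6 stmt-HubbardSuperconductivity-20236 `KLRegimeEngineV16`), stub `stub_engine_step_values`,
# conjunct (E2-v10) at `1 ≤ n`: the within-slice flow of the MODEL in Riccati form with EXPLICIT rungs — `klws_flow_source_eq`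

Cell gate-hubbard-kl, seat hubbard-kl-k3c1-p1 (g6), technique «composed-map remainder propagation».  Packaging of `klws_source_split` (p514357) in
the `t`-parametrisation of `kltc_riccati_duhamel_weighted` (p500198) / `klws_wickStep_of_scaleFlow` (p505675).  Along the affine path
`Λ(t) = Λ₀ + t(Λ₁ − Λ₀)` (`0 < Λ₁ ≤ Λ₀`, `Z^K ≠ 0` on the slice) take

* `Γ t := K_{Λ(t)}(Q)`, `Γ̇ t` its derivative (`klws_pairKernelR_flowData`),
* the RUNG `b t z := c(z)·(1 − w_{Λ(t)}(p))(1 − w_{Λ(t)}(p̄))`, `c(z) = −(βL²)⁻¹ĝ_K(p)ĝ_K(p̄)`, `p = (ν_z, p⃗_z)`, `p̄ = (−ν_z, Q − p⃗_z)`,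
  and `ḃ t z := c(z)·∂_t[(1 − w_{Λ(t)}(p))(1 − w_{Λ(t)}(p̄))]` (`…WickScaleFlowRungs`).

THEN (`klws_flow_source_eq`): (1) `hb`: entrywise `HasDerivAt (b · z) (ḃ t z) t` on `[0,1]`; (2) `hb'c`: `ḃ · z` continuous on `[0,1]`;
(3) **the source is the non-ladder part**: for all `t ∈ [0,1]`, `x y`,
`(Γ̇ t + Γ t·diag(ḃ t)·Γ t)(x,y) = (Λ₁ − Λ₀)·[ −½·𝒱₄(dblFold(Δ_×(Ċ)((e^{Δ_×(D)} − Δ_×(D))(W⁰W¹))))(Z(x,y)) − (βL²)⁻³·(PHd − PHx − 2·S62) ]_{Λ = Λ(t)}`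
— so the `hX` input of the Duhamel comparison is met by DEFINING `X` as the right side: two-vertex, non-ladder, every term gained or a leg dressing.

Exact algebra over p514357 + p509476; nothing about sizes or physics is asserted.  0 kit.
-/

noncomputable section

namespace Summit.HubbardSuperconductivity.HubbardSuperconductivity.Theorems.KLRegimeWick

set_option linter.dupNamespace false -- summit = problem name (single-conjunct summit), D-0017

open Set Literature.MathematicalPhysics.QuantumLattice GrassmannAlgebra Finset Matrix
open Literature.Probability.LatticeModels
open Summit.HubbardSuperconductivity.HubbardSuperconductivity.Theorems.TwoPointAssembly
open Summit.HubbardSuperconductivity.HubbardSuperconductivity.Theorems.KLProgrammeLegKernels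
open Summit.HubbardSuperconductivity.HubbardSuperconductivity.Theorems.KLRegimeSplit

section Model

variable (L M : ℕ) [NeZero L] [NeZero M] (β U μ : ℝ) (K : TrigPolyC4v)

omit [NeZero M] in
/-- The rung coefficient identity: `c(z)·(Λ₁ − Λ₀)(−ẇ(p)u(p̄) − u(p)ẇ(p̄)) = (Λ₁ − Λ₀)·(βL²)⁻³·λ_Λ(z)`,
`λ_Λ(z) = ℓ_D(p)ℓ_Ċ(p̄) + ℓ_Ċ(p)ℓ_D(p̄)`, `c(z) = −(βL²)⁻¹ĝ_K(p)ĝ_K(p̄)`. -/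
theorem klws_rungRate_eq (hβ : β ≠ 0) (Λ d : ℝ) (g g' : ℂ) (w₁ w₂ d₁ d₂ : ℝ) :
    -((((β * (L : ℝ) ^ 2 : ℝ) : ℂ))⁻¹ * g * g') * (((d * (-d₁ * (1 - w₂) - (1 - w₁) * d₂) : ℝ) : ℂ)) =
      ((d : ℝ) : ℂ) * (((((β * (L : ℝ) ^ 2 : ℝ) : ℂ)) ^ 3)⁻¹ *
        ((((1 - w₁ : ℝ) : ℂ) * (((β * (L : ℝ) ^ 2 : ℝ) : ℂ) * g)) * (((d₂ : ℝ) : ℂ) * (((β * (L : ℝ) ^ 2 : ℝ) : ℂ) * g')) +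
          (((d₁ : ℝ) : ℂ) * (((β * (L : ℝ) ^ 2 : ℝ) : ℂ) * g)) * ((((1 - w₂ : ℝ) : ℂ) * (((β * (L : ℝ) ^ 2 : ℝ) : ℂ) * g'))))) := by
  have hL : (L : ℝ) ≠ 0 := Nat.cast_ne_zero.2 (NeZero.ne L)
  have hb : (((β * (L : ℝ) ^ 2 : ℝ) : ℂ)) ≠ 0 := by exact_mod_cast mul_ne_zero hβ (pow_ne_zero 2 hL)
  have _ := Λ
  field_simp
  push_cast
  ring

/-- **The within-slice flow of the model in Riccati form with explicit rungs.**  See the module docstring: `Γ, Γ̇` as in `klws_pairKernelR_flowData`,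
`b, ḃ` the explicit soft-pair rungs (pass `rfl` four times); conclusions `hb`, `hb'c` and the identification of the source
`Γ̇ + Γ·diag ḃ·Γ` with `(Λ₁ − Λ₀)·[other line numbers + ph channels + S62]` at `Λ(t)`. -/
theorem klws_flow_source_eq (hβ : β ≠ 0) {Λ₀ Λ₁ : ℝ} (h10 : Λ₁ ≤ Λ₀) (h1 : 0 < Λ₁) (Q : TorusSite 2 L)
    (Γ Γ' : ℝ → Matrix (TorusSite 2 L × MatsubaraIdx M) (TorusSite 2 L × MatsubaraIdx M) ℂ)
    (b b' : ℝ → TorusSite 2 L × MatsubaraIdx M → ℂ)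
    (hΓdef : Γ = fun t => Matrix.of fun x y => vertexFn L M β
      (gaussConv ℂ (hubbardCovBelowCT L M β μ 0 K (Λ₀ + t * (Λ₁ - Λ₀)))
        (hubbardEffectiveActionCT L M β U μ 0 K (Λ₀ + t * (Λ₁ - Λ₀)))) 4
      ![(((y.2, y.1), 0), 0), (((y.2.rev, Q - y.1), 1), 0), (((x.2.rev, Q - x.1), 1), 1), (((x.2, x.1), 0), 1)])
    (hΓ'def : Γ' = fun t => Matrix.of fun x y => (Λ₁ - Λ₀) • -((2 : ℂ)⁻¹ * vertexFn L M β
      (gaussConv ℂ (hubbardCovBelowCT L M β μ 0 K (Λ₀ + t * (Λ₁ - Λ₀)))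
        (grassmannDerivPairing ℂ
          (Matrix.of fun X Y : HubbardFieldIdx L M =>
            deriv (fun Λ'' : ℝ => hubbardCovAboveCT L M β μ 0 K Λ'' X Y) (Λ₀ + t * (Λ₁ - Λ₀)))
          (hubbardEffectiveActionCT L M β U μ 0 K (Λ₀ + t * (Λ₁ - Λ₀)))
          (hubbardEffectiveActionCT L M β U μ 0 K (Λ₀ + t * (Λ₁ - Λ₀))))) 4
      ![(((y.2, y.1), 0), 0), (((y.2.rev, Q - y.1), 1), 0), (((x.2.rev, Q - x.1), 1), 1), (((x.2, x.1), 0), 1)]))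
    (hbdef : b = fun t z => -((((β * (L : ℝ) ^ 2 : ℝ) : ℂ))⁻¹ * propCT L M β μ K (z.2, z.1) * propCT L M β μ K (z.2.rev, Q - z.1)) *
      ((((1 - hubbardCutoffWeightCT L M β μ K (Λ₀ + t * (Λ₁ - Λ₀)) (z.2, z.1)) *
        (1 - hubbardCutoffWeightCT L M β μ K (Λ₀ + t * (Λ₁ - Λ₀)) (z.2.rev, Q - z.1)) : ℝ) : ℂ)))
    (hb'def : b' = fun t z => -((((β * (L : ℝ) ^ 2 : ℝ) : ℂ))⁻¹ * propCT L M β μ K (z.2, z.1) * propCT L M β μ K (z.2.rev, Q - z.1)) *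
      ((((Λ₁ - Λ₀) * (-deriv (fun Λ' : ℝ => hubbardCutoffWeightCT L M β μ K Λ' (z.2, z.1)) (Λ₀ + t * (Λ₁ - Λ₀)) *
          (1 - hubbardCutoffWeightCT L M β μ K (Λ₀ + t * (Λ₁ - Λ₀)) (z.2.rev, Q - z.1)) -
        (1 - hubbardCutoffWeightCT L M β μ K (Λ₀ + t * (Λ₁ - Λ₀)) (z.2, z.1)) *
          deriv (fun Λ' : ℝ => hubbardCutoffWeightCT L M β μ K Λ' (z.2.rev, Q - z.1)) (Λ₀ + t * (Λ₁ - Λ₀))) : ℝ) : ℂ))) :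
    (∀ t ∈ Icc (0 : ℝ) 1, ∀ z, HasDerivAt (fun s => b s z) (b' t z) t) ∧
    (∀ z, ContinuousOn (fun t => b' t z) (Icc 0 1)) ∧
    ∀ t ∈ Icc (0 : ℝ) 1, ∀ x y : TorusSite 2 L × MatsubaraIdx M,
      (Γ' t + Γ t * diagonal (b' t) * Γ t) x y =
        ((Λ₁ - Λ₀ : ℝ) : ℂ) *
          (-((2 : ℂ)⁻¹ * vertexFn L M β (dblFold ℂ (grassmannLaplacian ℂ
              (crossCov ℂ (Matrix.of fun X Y : HubbardFieldIdx L M =>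
                deriv (fun Λ' : ℝ => hubbardCovAboveCT L M β μ 0 K Λ' X Y) (Λ₀ + t * (Λ₁ - Λ₀))))
              ((gaussConv ℂ (crossCov ℂ (hubbardCovBelowCT L M β μ 0 K (Λ₀ + t * (Λ₁ - Λ₀)))) -
                  grassmannLaplacian ℂ (crossCov ℂ (hubbardCovBelowCT L M β μ 0 K (Λ₀ + t * (Λ₁ - Λ₀)))))
                (dblCopy ℂ 0 (gaussConv ℂ (hubbardCovBelowCT L M β μ 0 K (Λ₀ + t * (Λ₁ - Λ₀)))
                    (hubbardEffectiveActionCT L M β U μ 0 K (Λ₀ + t * (Λ₁ - Λ₀)))) *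
                  dblCopy ℂ 1 (gaussConv ℂ (hubbardCovBelowCT L M β μ 0 K (Λ₀ + t * (Λ₁ - Λ₀)))
                    (hubbardEffectiveActionCT L M β U μ 0 K (Λ₀ + t * (Λ₁ - Λ₀)))))))) 4
              ![(((y.2, y.1), 0), 0), (((y.2.rev, Q - y.1), 1), 0), (((x.2.rev, Q - x.1), 1), 1), (((x.2, x.1), 0), 1)]) -
            ((((β * (L : ℝ) ^ 2 : ℝ) : ℂ)) ^ 3)⁻¹ *
              ((∑ p : FreqMomentum L M, ∑ σ : Fin 2, ∑ p' : FreqMomentum L M,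
                  if matsubaraInt M p'.1 + matsubaraInt M y.2 = matsubaraInt M p.1 + matsubaraInt M x.2 ∧ p'.2 = p.2 + x.1 - y.1 then
                    ((((1 - hubbardCutoffWeightCT L M β μ K (Λ₀ + t * (Λ₁ - Λ₀)) p : ℝ) : ℂ) *
                          (((β * (L : ℝ) ^ 2 : ℝ) : ℂ) * propCT L M β μ K p)) *
                        (((deriv (fun Λ' : ℝ => hubbardCutoffWeightCT L M β μ K Λ' p') (Λ₀ + t * (Λ₁ - Λ₀)) : ℝ) : ℂ) *
                          (((β * (L : ℝ) ^ 2 : ℝ) : ℂ) * propCT L M β μ K p')) +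
                      (((deriv (fun Λ' : ℝ => hubbardCutoffWeightCT L M β μ K Λ' p) (Λ₀ + t * (Λ₁ - Λ₀)) : ℝ) : ℂ) *
                          (((β * (L : ℝ) ^ 2 : ℝ) : ℂ) * propCT L M β μ K p)) *
                        ((((1 - hubbardCutoffWeightCT L M β μ K (Λ₀ + t * (Λ₁ - Λ₀)) p' : ℝ) : ℂ) *
                          (((β * (L : ℝ) ^ 2 : ℝ) : ℂ) * propCT L M β μ K p')))) *
                      (vertexFn L M β (gaussConv ℂ (hubbardCovBelowCT L M β μ 0 K (Λ₀ + t * (Λ₁ - Λ₀)))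
                            (hubbardEffectiveActionCT L M β U μ 0 K (Λ₀ + t * (Λ₁ - Λ₀)))) 4
                          ![((p, σ), 1), ((p', σ), 0), (((y.2, y.1), 0), 0), (((x.2, x.1), 0), 1)] *
                        vertexFn L M β (gaussConv ℂ (hubbardCovBelowCT L M β μ 0 K (Λ₀ + t * (Λ₁ - Λ₀)))
                            (hubbardEffectiveActionCT L M β U μ 0 K (Λ₀ + t * (Λ₁ - Λ₀)))) 4
                          ![((p, σ), 0), ((p', σ), 1), (((y.2.rev, Q - y.1), 1), 0), (((x.2.rev, Q - x.1), 1), 1)])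
                  else 0) -
                (∑ p : FreqMomentum L M, ∑ p' : FreqMomentum L M,
                  if matsubaraInt M p'.1 + matsubaraInt M x.2 + matsubaraInt M y.2 + 1 = matsubaraInt M p.1 ∧
                      p'.2 = p.2 + Q - x.1 - y.1 then
                    ((((1 - hubbardCutoffWeightCT L M β μ K (Λ₀ + t * (Λ₁ - Λ₀)) p : ℝ) : ℂ) *
                          (((β * (L : ℝ) ^ 2 : ℝ) : ℂ) * propCT L M β μ K p)) *
                        (((deriv (fun Λ' : ℝ => hubbardCutoffWeightCT L M β μ K Λ' p') (Λ₀ + t * (Λ₁ - Λ₀)) : ℝ) : ℂ) *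
                          (((β * (L : ℝ) ^ 2 : ℝ) : ℂ) * propCT L M β μ K p')) +
                      (((deriv (fun Λ' : ℝ => hubbardCutoffWeightCT L M β μ K Λ' p) (Λ₀ + t * (Λ₁ - Λ₀)) : ℝ) : ℂ) *
                          (((β * (L : ℝ) ^ 2 : ℝ) : ℂ) * propCT L M β μ K p)) *
                        ((((1 - hubbardCutoffWeightCT L M β μ K (Λ₀ + t * (Λ₁ - Λ₀)) p' : ℝ) : ℂ) *
                          (((β * (L : ℝ) ^ 2 : ℝ) : ℂ) * propCT L M β μ K p')))) *
                      (vertexFn L M β (gaussConv ℂ (hubbardCovBelowCT L M β μ 0 K (Λ₀ + t * (Λ₁ - Λ₀)))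
                            (hubbardEffectiveActionCT L M β U μ 0 K (Λ₀ + t * (Λ₁ - Λ₀)))) 4
                          ![((p, 0), 1), ((p', 1), 0), (((y.2, y.1), 0), 0), (((x.2.rev, Q - x.1), 1), 1)] *
                        vertexFn L M β (gaussConv ℂ (hubbardCovBelowCT L M β μ 0 K (Λ₀ + t * (Λ₁ - Λ₀)))
                            (hubbardEffectiveActionCT L M β U μ 0 K (Λ₀ + t * (Λ₁ - Λ₀)))) 4
                          ![((p, 0), 0), ((p', 1), 1), (((y.2.rev, Q - y.1), 1), 0), (((x.2, x.1), 0), 1)])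
                  else 0) -
                2 * ∑ p : FreqMomentum L M, ∑ σ : Fin 2,
                  ((((deriv (fun Λ' : ℝ => hubbardCutoffWeightCT L M β μ K Λ' p) (Λ₀ + t * (Λ₁ - Λ₀)) : ℝ) : ℂ) *
                      (((β * (L : ℝ) ^ 2 : ℝ) : ℂ) * propCT L M β μ K p)) *
                    (((1 - hubbardCutoffWeightCT L M β μ K (Λ₀ + t * (Λ₁ - Λ₀)) p : ℝ) : ℂ) *
                      (((β * (L : ℝ) ^ 2 : ℝ) : ℂ) * propCT L M β μ K p))) *
                  (vertexFn L M β (gaussConv ℂ (hubbardCovBelowCT L M β μ 0 K (Λ₀ + t * (Λ₁ - Λ₀)))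
                        (hubbardEffectiveActionCT L M β U μ 0 K (Λ₀ + t * (Λ₁ - Λ₀)))) 6
                      ![((p, σ), 0), ((p, σ), 1), (((y.2, y.1), 0), 0), (((y.2.rev, Q - y.1), 1), 0), (((x.2.rev, Q - x.1), 1), 1),
                        (((x.2, x.1), 0), 1)] *
                    selfEnergy L M β (gaussConv ℂ (hubbardCovBelowCT L M β μ 0 K (Λ₀ + t * (Λ₁ - Λ₀)))
                      (hubbardEffectiveActionCT L M β U μ 0 K (Λ₀ + t * (Λ₁ - Λ₀)))) p σ))) := by
  subst hbdef hb'def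
  refine ⟨fun t ht z => ?_, fun z => ?_, fun t ht x y => ?_⟩
  · -- (1) the rung is differentiable along the path
    have h := ((klws_hasDerivAt_softWeightPair_path L M β μ K h10 h1 ht (z.2, z.1) (z.2.rev, Q - z.1)).ofReal_comp).const_mul
      (-((((β * (L : ℝ) ^ 2 : ℝ) : ℂ))⁻¹ * propCT L M β μ K (z.2, z.1) * propCT L M β μ K (z.2.rev, Q - z.1)))
    simpa only [Function.comp_def] using h
  · -- (2) the rung derivative is continuous along the path
    have h := (klws_continuousOn_softWeightPair_deriv_path L M β μ K h10 h1 (z.2, z.1) (z.2.rev, Q - z.1))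
    exact continuousOn_const.mul (Complex.continuous_ofReal.comp_continuousOn h)
  · -- (3) the source is the non-ladder part
    have hne : Λ₀ + t * (Λ₁ - Λ₀) ≠ 0 := (h1.trans_le (klws_affine_mem_Icc h10 ht).1).ne'
    subst hΓdef hΓ'def
    rw [Matrix.add_apply, klli_mul_diag_mul_apply]
    simp only [Matrix.of_apply]
    rw [klws_gaussConv_derivPairing_eq_dblFold_cross ℂ _ _ (klws_derivHardCov_transpose L M β μ K _)
      (klws_effectiveActionR_mem_evenOdd_zero β U μ K _), Complex.real_smul,
      klws_source_split L M β U μ K hβ hne Q x y]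
    -- the Riccati term against `Γ·diag ḃ·Γ`
    have hrung : ∀ z : TorusSite 2 L × MatsubaraIdx M,
        vertexFn L M β (gaussConv ℂ (hubbardCovBelowCT L M β μ 0 K (Λ₀ + t * (Λ₁ - Λ₀))) (hubbardEffectiveActionCT L M β U μ 0 K (Λ₀ + t * (Λ₁ - Λ₀)))) 4
            ![(((z.2, z.1), 0), 0), (((z.2.rev, Q - z.1), 1), 0), (((x.2.rev, Q - x.1), 1), 1), (((x.2, x.1), 0), 1)] *
          ((-((((β * (L : ℝ) ^ 2 : ℝ) : ℂ))⁻¹ * propCT L M β μ K (z.2, z.1) * propCT L M β μ K (z.2.rev, Q - z.1))) *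
            ((((Λ₁ - Λ₀) * (-deriv (fun Λ' : ℝ => hubbardCutoffWeightCT L M β μ K Λ' (z.2, z.1)) (Λ₀ + t * (Λ₁ - Λ₀)) *
              (1 - hubbardCutoffWeightCT L M β μ K (Λ₀ + t * (Λ₁ - Λ₀)) (z.2.rev, Q - z.1)) -
            (1 - hubbardCutoffWeightCT L M β μ K (Λ₀ + t * (Λ₁ - Λ₀)) (z.2, z.1)) *
              deriv (fun Λ' : ℝ => hubbardCutoffWeightCT L M β μ K Λ' (z.2.rev, Q - z.1)) (Λ₀ + t * (Λ₁ - Λ₀)))) : ℝ) : ℂ)) *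
          vertexFn L M β (gaussConv ℂ (hubbardCovBelowCT L M β μ 0 K (Λ₀ + t * (Λ₁ - Λ₀))) (hubbardEffectiveActionCT L M β U μ 0 K (Λ₀ + t * (Λ₁ - Λ₀)))) 4
            ![(((y.2, y.1), 0), 0), (((y.2.rev, Q - y.1), 1), 0), (((z.2.rev, Q - z.1), 1), 1), (((z.2, z.1), 0), 1)] =
        ((Λ₁ - Λ₀ : ℝ) : ℂ) * (((((β * (L : ℝ) ^ 2 : ℝ) : ℂ)) ^ 3)⁻¹ *
          ((((1 - hubbardCutoffWeightCT L M β μ K (Λ₀ + t * (Λ₁ - Λ₀)) (z.2, z.1) : ℝ) : ℂ) * (((β * (L : ℝ) ^ 2 : ℝ) : ℂ) * propCT L M β μ K (z.2, z.1)) *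
              (((deriv (fun Λ' : ℝ => hubbardCutoffWeightCT L M β μ K Λ' (z.2.rev, Q - z.1)) (Λ₀ + t * (Λ₁ - Λ₀)) : ℝ) : ℂ) *
                (((β * (L : ℝ) ^ 2 : ℝ) : ℂ) * propCT L M β μ K (z.2.rev, Q - z.1))) +
            ((deriv (fun Λ' : ℝ => hubbardCutoffWeightCT L M β μ K Λ' (z.2, z.1)) (Λ₀ + t * (Λ₁ - Λ₀)) : ℝ) : ℂ) *
                (((β * (L : ℝ) ^ 2 : ℝ) : ℂ) * propCT L M β μ K (z.2, z.1)) *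
              (((1 - hubbardCutoffWeightCT L M β μ K (Λ₀ + t * (Λ₁ - Λ₀)) (z.2.rev, Q - z.1) : ℝ) : ℂ) * (((β * (L : ℝ) ^ 2 : ℝ) : ℂ) * propCT L M β μ K (z.2.rev, Q - z.1)))) *
          (vertexFn L M β (gaussConv ℂ (hubbardCovBelowCT L M β μ 0 K (Λ₀ + t * (Λ₁ - Λ₀))) (hubbardEffectiveActionCT L M β U μ 0 K (Λ₀ + t * (Λ₁ - Λ₀)))) 4
            ![(((z.2, z.1), 0), 0), (((z.2.rev, Q - z.1), 1), 0), (((x.2.rev, Q - x.1), 1), 1), (((x.2, x.1), 0), 1)] *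
            vertexFn L M β (gaussConv ℂ (hubbardCovBelowCT L M β μ 0 K (Λ₀ + t * (Λ₁ - Λ₀))) (hubbardEffectiveActionCT L M β U μ 0 K (Λ₀ + t * (Λ₁ - Λ₀)))) 4
            ![(((y.2, y.1), 0), 0), (((y.2.rev, Q - y.1), 1), 0), (((z.2.rev, Q - z.1), 1), 1), (((z.2, z.1), 0), 1)]))) := by
      intro z
      rw [klws_rungRate_eq L β hβ (Λ₀ + t * (Λ₁ - Λ₀)) (Λ₁ - Λ₀)]
      ring
    simp only [hrung, ← Finset.mul_sum]
    ring

end Model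

end Summit.HubbardSuperconductivity.HubbardSuperconductivity.Theorems.KLRegimeWick

end
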